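import Mathlib
import HarnessLib
import Summits.KontsevichZagierPeriods.Zeta5Search.TwoTaleSecondTaleLineRep
import Summits.KontsevichZagierPeriods.Zeta5Search.TwoTaleP15SecondTale
import Summits.KontsevichZagierPeriods.Zeta5Search.Denom.TwoTaleP15Bridge
import Summits.KontsevichZagierPeriods.Zeta5Search.Denom.TwoTaleP15StripShift

/-!
# Second tale at the P15 partner: the strip shift `‖lineT(m + ½)‖ = ‖lineT(½)‖`, `m ≤ 11n`

HONEST FRAMING: systematic search; no irrationality claim unless certified.  Cell pub-zeta5, class `measure`
(fam-measure g5, file U2-4 of the tale-2 decay chain for `Denom.TwoTaleP15Coincidence.DecayT`; design value,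
formalisation pending).  Pure analysis; no zeta values beyond the defined constant `zetaValue 2` of U2-3.

At the partner `â = (32n+2; 11n+1, 13n+1, 15n+1)`, `b̂ = (15n+2; 6n+1, 24n+2, 26n+2)` of [Zudilin2014ZetaTwo,
Section 6] (`TwoTaleP15.aT/bT`; `â₀* = 26n+2`) the shifted function `g(u) = R̂((u − â₀*)/2)` is, in the doubled
variable `u`, `Π̂ · U[15n+2,32n+2) · H[6n+1,11n+1) / (H[13n+1,24n+2) · H[15n+1,26n+2))` with `U[lo,hi)(u) =
∏ (u − â₀* + i)` and `H[lo,hi)(u) = ∏ ((u − â₀*)/2 + i)` (`gT_eq`).  Hence `g(m) = 0` for `1 ≤ m ≤ 11n`, `g` is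
holomorphic of polynomial growth on every closed strip `|Re u − m| ≤ ½`, `1 ≤ m ≤ 11n`, and U2-2's first-power strip
step gives **`lineT(m + ½) = (−1)^m · lineT(½)`** (`stripShiftT`), so that with U2-3
**`|q̂ₙ ζ(2) − p̂ₙ| = ‖∫ sech1(y) g(m + ½ + iy) dy‖ / (4π) ≤ (4π)⁻¹ ∫ sech1(y) ‖g(m + ½ + iy)‖ dy`** for every
`m ≤ 11n` (`abs_formT_le_of_line`) — the input of the scaled line bound (U2-5).
-/

noncomputable section

open Complex MeasureTheory Finset Polynomial
open Literature.NumberTheory.Transcendental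
open Literature.NumberTheory.Irrationality.Zudilin2014
open Summit.KontsevichZagierPeriods.Zeta5Search.TwoTaleP15 (aT bT admissibleT)
open Summit.KontsevichZagierPeriods.Zeta5Search.Denom.KernelStripStep
open Summit.KontsevichZagierPeriods.Zeta5Search.Denom.TwoTaleP15StripShift (half_le_re_of_mem_halfStrip
  one_add_abs_sq_le_two_mul)
open Summit.KontsevichZagierPeriods.Zeta5Search.TwoTaleSechKernel
open Summit.KontsevichZagierPeriods.Zeta5Search.TwoTaleSechMoments
open Summit.KontsevichZagierPeriods.Zeta5Search.TwoTaleSecondTaleLineRep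

namespace Summit.KontsevichZagierPeriods.Zeta5Search.TwoTaleSecondTaleStripShift

/-! ### The blocks of `g(u) = R̂((u − â₀*)/2)` -/

/-- A doubled block `∏_{i ∈ [lo,hi)} (u − â₀* + i)` (from `block2`), `â₀* = 26n+2`. -/
def uBlock (n lo hi : ℕ) (u : ℂ) : ℂ := ∏ i ∈ Ico lo hi, (u - (26 * n + 2) + i)

/-- A half block `∏_{i ∈ [lo,hi)} ((u − â₀*)/2 + i)` (from `block`), `â₀* = 26n+2`. -/
def hBlock (n lo hi : ℕ) (u : ℂ) : ℂ := ∏ i ∈ Ico lo hi, ((u - (26 * n + 2)) / 2 + i)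

/-- The shifted rational function `g(u) = R̂(âₙ, b̂ₙ; (u − â₀*)/2)` in the doubled variable. -/
def gT (n : ℕ) (u : ℂ) : ℂ := RCT (aT n) (bT n) ((u - (26 * n + 2)) / 2)

/-- `â₀* = 26n+2` at the partner. -/
theorem a0star_T (n : ℕ) : a0star (aT n) = 26 * n + 2 := by
  unfold a0star aMid; simp; omega

/-- `â₀*` over `ℂ`. -/
theorem a0star_T_castC (n : ℕ) : ((a0star (aT n) : ℤ) : ℂ) = 26 * n + 2 := by
  rw [a0star_T]; push_cast; ring

/-- `aeval` of a `block` at `(u − â₀*)/2` is the half block. -/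
theorem aeval_block_eq_hBlock (n lo hi : ℕ) (u : ℂ) :
    aeval ((u - (26 * n + 2)) / 2) (block (lo : ℤ) (hi : ℤ)) = hBlock n lo hi u := by
  rw [aeval_block_complex, Denom.TwoTaleP15Bridge.Ico_natCast_eq_map, Finset.prod_map]
  simp only [Nat.castEmbedding_apply, Int.cast_natCast]
  rfl

/-- `aeval` of a `block2` at `(u − â₀*)/2` is the doubled block. -/
theorem aeval_block2_eq_uBlock (n lo hi : ℕ) (u : ℂ) :
    aeval ((u - (26 * n + 2)) / 2) (block2 (lo : ℤ) (hi : ℤ)) = uBlock n lo hi u := by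
  unfold block2 uBlock
  rw [map_prod, Denom.TwoTaleP15Bridge.Ico_natCast_eq_map, Finset.prod_map]
  refine prod_congr rfl fun i _ => ?_
  simp only [Nat.castEmbedding_apply, Int.cast_natCast, map_add, map_mul, aeval_C, aeval_X, map_natCast]
  rw [show algebraMap ℚ ℂ 2 = 2 from map_ofNat _ 2]
  ring

/-- **`g` as a product of blocks**: `g = Π̂ · U[15n+2,32n+2)·H[6n+1,11n+1) / (H[13n+1,24n+2)·H[15n+1,26n+2))`. -/
theorem gT_eq (n : ℕ) (u : ℂ) : gT n u =
    ((normT (aT n) (bT n) : ℚ) : ℂ) * (uBlock n (15 * n + 2) (32 * n + 2) u * hBlock n (6 * n + 1) (11 * n + 1) u) /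
      (hBlock n (13 * n + 1) (24 * n + 2) u * hBlock n (15 * n + 1) (26 * n + 2) u) := by
  obtain ⟨e0, e0', e1, e1', e2, e2', e3, e3'⟩ : bT n 0 = ((15 * n + 2 : ℕ) : ℤ) ∧ aT n 0 = ((32 * n + 2 : ℕ) : ℤ) ∧
      bT n 1 = ((6 * n + 1 : ℕ) : ℤ) ∧ aT n 1 = ((11 * n + 1 : ℕ) : ℤ) ∧ aT n 2 = ((13 * n + 1 : ℕ) : ℤ) ∧
      bT n 2 = ((24 * n + 2 : ℕ) : ℤ) ∧ aT n 3 = ((15 * n + 1 : ℕ) : ℤ) ∧ bT n 3 = ((26 * n + 2 : ℕ) : ℤ) := by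
    refine ⟨?_, ?_, ?_, ?_, ?_, ?_, ?_, ?_⟩ <;> simp
  unfold gT RCT numT denT
  rw [map_mul, map_mul, map_mul, aeval_C, eq_ratCast, e0, e0', e1, e1', e2, e2', e3, e3', aeval_block2_eq_uBlock,
    aeval_block_eq_hBlock, aeval_block_eq_hBlock, aeval_block_eq_hBlock]

/-- Each doubled block is entire. -/
@[fun_prop] theorem differentiable_uBlock (n lo hi : ℕ) : Differentiable ℂ (uBlock n lo hi) := by
  unfold uBlock; fun_prop

/-- Each half block is entire. -/
@[fun_prop] theorem differentiable_hBlock (n lo hi : ℕ) : Differentiable ℂ (hBlock n lo hi) := by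
  unfold hBlock; fun_prop

/-- Real part of a half factor: `Re ((u − â₀*)/2 + i) = (Re u − â₀*)/2 + i`. -/
theorem re_hFactor (n i : ℕ) (u : ℂ) : ((u - (26 * n + 2)) / 2 + i).re = (u.re - (26 * n + 2)) / 2 + i := by
  have : ((u - (26 * n + 2)) / 2 + i : ℂ) = u * (((1 / 2 : ℝ)) : ℂ) + (((i : ℝ) - (13 * n + 1) : ℝ) : ℂ) := by
    push_cast; ring
  rw [this, add_re, ofReal_re, mul_comm, re_ofReal_mul]
  ring

/-- A polar half factor (`i ≥ 13n+1`) has real part `≥ ¼` on `Re u ≥ ½`. -/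
theorem re_hFactor_ge {n i : ℕ} (hi : 13 * n + 1 ≤ i) {u : ℂ} (hu : 1 / 2 ≤ u.re) :
    1 / 4 ≤ ((u - (26 * n + 2)) / 2 + i).re := by
  have h : ((13 * n + 1 : ℕ) : ℝ) ≤ (i : ℝ) := by exact_mod_cast hi
  push_cast at h; rw [re_hFactor]
  linarith

/-- A polar half block (`lo ≥ 13n+1`) does not vanish on `Re u ≥ ½` … -/
theorem hBlock_ne_zero {n lo hi : ℕ} (hlo : 13 * n + 1 ≤ lo) {u : ℂ} (hu : 1 / 2 ≤ u.re) : hBlock n lo hi u ≠ 0 := by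
  rw [hBlock]
  refine Finset.prod_ne_zero_iff.2 fun i hi h => ?_
  have h1 := re_hFactor_ge (n := n) (hlo.trans (Finset.mem_Ico.1 hi).1) hu
  rw [h, zero_re] at h1
  linarith

/-- … and has norm `≥ (1/4)^{hi−lo}` there. -/
theorem pow_le_norm_hBlock {n lo hi : ℕ} (hlo : 13 * n + 1 ≤ lo) {u : ℂ} (hu : 1 / 2 ≤ u.re) :
    (1 / 4 : ℝ) ^ (hi - lo) ≤ ‖hBlock n lo hi u‖ := by
  rw [hBlock, norm_prod, ← Nat.card_Ico lo hi, ← Finset.prod_const]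
  refine Finset.prod_le_prod (fun _ _ => by norm_num) fun i hi => ?_
  exact (re_hFactor_ge (n := n) (hlo.trans (Finset.mem_Ico.1 hi).1) hu).trans (re_le_norm _)

/-- A doubled block containing the index `â₀* − m` vanishes at `u = m`. -/
theorem uBlock_natCast_eq_zero {n lo hi m : ℕ} (hlo : lo + m ≤ 26 * n + 2) (hhi : 26 * n + 2 < hi + m) :
    uBlock n lo hi (m : ℂ) = 0 := by
  rw [uBlock]
  have hm : m ≤ 26 * n + 2 := by omega
  refine Finset.prod_eq_zero (i := 26 * n + 2 - m) (Finset.mem_Ico.2 ⟨by omega, by omega⟩) ?_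
  rw [Nat.cast_sub hm]; push_cast; ring

/-! ### The hypotheses of the first-power strip step at `m = 1, …, 11n` -/

/-- `g` as a function (for `fun_prop`). -/
theorem gT_eq_fun (n : ℕ) : gT n = fun u => ((normT (aT n) (bT n) : ℚ) : ℂ) *
    (uBlock n (15 * n + 2) (32 * n + 2) u * hBlock n (6 * n + 1) (11 * n + 1) u) /
      (hBlock n (13 * n + 1) (24 * n + 2) u * hBlock n (15 * n + 1) (26 * n + 2) u) :=
  funext (gT_eq n)

/-- **Zeros**: `g(m) = 0` for `1 ≤ m ≤ 11n` (the doubled block `U[15n+2, 32n+2)` vanishes). -/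
theorem gT_natCast {n m : ℕ} (h1 : 1 ≤ m) (h11 : m ≤ 11 * n) : gT n (m : ℂ) = 0 := by
  rw [gT_eq, uBlock_natCast_eq_zero (lo := 15 * n + 2) (hi := 32 * n + 2) (by omega) (by omega)]
  simp

/-- The polar part does not vanish on the closed strip around `m ≥ 1`. -/
theorem den_ne_zero (n : ℕ) {m : ℕ} (h1 : 1 ≤ m) {u : ℂ} (hu : u ∈ halfStrip (m : ℤ)) :
    hBlock n (13 * n + 1) (24 * n + 2) u * hBlock n (15 * n + 1) (26 * n + 2) u ≠ 0 :=
  mul_ne_zero (hBlock_ne_zero le_rfl (half_le_re_of_mem_halfStrip h1 hu))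
    (hBlock_ne_zero (by omega) (half_le_re_of_mem_halfStrip h1 hu))

/-- **Holomorphy**: `g` is holomorphic on the closed strip `|Re u − m| ≤ ½`, `m ≥ 1`. -/
theorem differentiableOn_gT (n : ℕ) {m : ℕ} (h1 : 1 ≤ m) : DifferentiableOn ℂ (gT n) (halfStrip (m : ℤ)) := by
  have hden : ∀ u ∈ halfStrip (m : ℤ),
      hBlock n (13 * n + 1) (24 * n + 2) u * hBlock n (15 * n + 1) (26 * n + 2) u ≠ 0 := fun u hu => den_ne_zero n h1 hu
  rw [gT_eq_fun]
  fun_prop (disch := first | assumption | exact hden)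

/-! ### Polynomial growth on the strips -/

/-- A doubled factor on the strip around `m ≤ 11n`: `‖u − â₀* + i‖ ≤ (70n+4)(1+|Im u|)` for `i < 32n+2`. -/
theorem norm_uFactor_le {n m i : ℕ} (hm : m ≤ 11 * n) (hi : i < 32 * n + 2) {u : ℂ}
    (hu : u ∈ halfStrip (m : ℤ)) : ‖u - (26 * n + 2) + i‖ ≤ (70 * n + 4) * (1 + |u.im|) := by
  simp only [halfStrip, Set.mem_preimage, Set.mem_Icc, Int.cast_natCast] at hu
  have hm' : (m : ℝ) ≤ 11 * n := by exact_mod_cast hm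
  have hi' : (i : ℝ) ≤ 32 * n + 1 := by exact_mod_cast (by omega : i ≤ 32 * n + 1)
  have hn : (0 : ℝ) ≤ n := Nat.cast_nonneg n
  have h1 : ‖u - (26 * n + 2) + i‖ ≤ ‖u‖ + ‖((26 * n + 2 : ℕ) : ℂ)‖ + ‖(i : ℂ)‖ := by
    calc ‖u - (26 * n + 2) + i‖ ≤ ‖u - (26 * n + 2)‖ + ‖(i : ℂ)‖ := norm_add_le _ _
      _ ≤ ‖u‖ + ‖((26 * n + 2 : ℕ) : ℂ)‖ + ‖(i : ℂ)‖ := by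
          have h := norm_sub_le u (((26 * n + 2 : ℕ) : ℂ))
          push_cast at h ⊢
          linarith
  rw [Complex.norm_natCast, Complex.norm_natCast] at h1
  push_cast at h1
  have h2 : ‖u‖ ≤ |u.re| + |u.im| := norm_le_abs_re_add_abs_im u
  have h3 : |u.re| ≤ 11 * n + 1 := abs_le.2 ⟨by linarith [hu.1, hu.2], by linarith [hu.1, hu.2]⟩
  have h4 : 0 ≤ |u.im| := abs_nonneg _
  nlinarith [mul_nonneg (by positivity : (0 : ℝ) ≤ 70 * n + 3) h4]

/-- A half factor on the strip around `m ≤ 11n`: `‖(u − â₀*)/2 + i‖ ≤ (70n+4)(1+|Im u|)` for `i < 32n+2`. -/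
theorem norm_hFactor_le {n m i : ℕ} (hm : m ≤ 11 * n) (hi : i < 32 * n + 2) {u : ℂ}
    (hu : u ∈ halfStrip (m : ℤ)) : ‖(u - (26 * n + 2)) / 2 + i‖ ≤ (70 * n + 4) * (1 + |u.im|) := by
  have h := norm_uFactor_le hm hi hu
  have e : ((u - (26 * n + 2)) / 2 + i : ℂ) = (u - (26 * n + 2) + i) / 2 + (i : ℂ) / 2 := by ring
  have hi2 : ‖(i : ℂ) / 2‖ ≤ ‖u - (26 * n + 2) + i‖ / 2 + ‖(i : ℂ)‖ / 2 := by
    rw [norm_div, Complex.norm_two]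
    linarith [norm_nonneg (u - (26 * n + 2) + i)]
  have hi3 : ‖(i : ℂ)‖ ≤ (70 * n + 4) * (1 + |u.im|) := by
    rw [Complex.norm_natCast]
    have : (i : ℝ) ≤ 32 * n + 1 := by exact_mod_cast (by omega : i ≤ 32 * n + 1)
    nlinarith [abs_nonneg u.im, Nat.cast_nonneg (α := ℝ) n]
  calc ‖(u - (26 * n + 2)) / 2 + (i : ℂ)‖ = ‖(u - (26 * n + 2) + i) / 2 + (i : ℂ) / 2‖ := by rw [e]
    _ ≤ ‖(u - (26 * n + 2) + i) / 2‖ + ‖(i : ℂ) / 2‖ := norm_add_le _ _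
    _ ≤ (70 * n + 4) * (1 + |u.im|) := by
        rw [norm_div, Complex.norm_two, norm_div, Complex.norm_two]
        linarith

/-- A doubled block on the strip: `‖U[lo,hi)(u)‖ ≤ ((70n+4)(1+|Im u|))^{hi−lo}` (`hi ≤ 32n+2`). -/
theorem norm_uBlock_le {n m lo hi : ℕ} (hm : m ≤ 11 * n) (hhi : hi ≤ 32 * n + 2) {u : ℂ}
    (hu : u ∈ halfStrip (m : ℤ)) : ‖uBlock n lo hi u‖ ≤ ((70 * n + 4) * (1 + |u.im|)) ^ (hi - lo) := by
  rw [uBlock, norm_prod, ← Nat.card_Ico lo hi, ← Finset.prod_const]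
  refine Finset.prod_le_prod (fun i _ => norm_nonneg _) fun i hi' => ?_
  exact norm_uFactor_le hm (by have := (Finset.mem_Ico.1 hi').2; omega) hu

/-- A half block on the strip: `‖H[lo,hi)(u)‖ ≤ ((70n+4)(1+|Im u|))^{hi−lo}` (`hi ≤ 32n+2`). -/
theorem norm_hBlock_le {n m lo hi : ℕ} (hm : m ≤ 11 * n) (hhi : hi ≤ 32 * n + 2) {u : ℂ}
    (hu : u ∈ halfStrip (m : ℤ)) : ‖hBlock n lo hi u‖ ≤ ((70 * n + 4) * (1 + |u.im|)) ^ (hi - lo) := by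
  rw [hBlock, norm_prod, ← Nat.card_Ico lo hi, ← Finset.prod_const]
  refine Finset.prod_le_prod (fun i _ => norm_nonneg _) fun i hi' => ?_
  exact norm_hFactor_le hm (by have := (Finset.mem_Ico.1 hi').2; omega) hu

/-- **Growth**: on the strip around `m ∈ [1, 11n]`, `‖g(u)‖ ≤ A · (1 + (Im u)²)^{11n}` with
`A = |Π̂| (70n+4)^{22n} 2^{11n} 4^{22n+2}`. -/
theorem norm_gT_le {n m : ℕ} (h1 : 1 ≤ m) (hm : m ≤ 11 * n) {u : ℂ} (hu : u ∈ halfStrip (m : ℤ)) :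
    ‖gT n u‖ ≤ (‖((normT (aT n) (bT n) : ℚ) : ℂ)‖ * (70 * n + 4) ^ (22 * n) * 2 ^ (11 * n) * 4 ^ (22 * n + 2)) *
      (1 + u.im ^ 2) ^ (11 * n) := by
  have hre : 1 / 2 ≤ u.re := half_le_re_of_mem_halfStrip h1 hu
  set b : ℝ := (70 * n + 4) * (1 + |u.im|) with hb
  have hU := norm_uBlock_le (lo := 15 * n + 2) (hi := 32 * n + 2) hm le_rfl hu
  have hH := norm_hBlock_le (lo := 6 * n + 1) (hi := 11 * n + 1) hm (by omega) hu
  rw [show 32 * n + 2 - (15 * n + 2) = 17 * n by omega] at hU; rw [show 11 * n + 1 - (6 * n + 1) = 5 * n by omega] at hH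
  have hD2 := pow_le_norm_hBlock (n := n) (lo := 13 * n + 1) (hi := 24 * n + 2) le_rfl hre
  have hD3 := pow_le_norm_hBlock (n := n) (lo := 15 * n + 1) (hi := 26 * n + 2) (by omega) hre
  rw [show 24 * n + 2 - (13 * n + 1) = 11 * n + 1 by omega] at hD2; rw [show 26 * n + 2 - (15 * n + 1) = 11 * n + 1 by omega] at hD3
  have hD : 1 / 4 ^ (22 * n + 2) ≤
      ‖hBlock n (13 * n + 1) (24 * n + 2) u‖ * ‖hBlock n (15 * n + 1) (26 * n + 2) u‖ := by
    have h := mul_le_mul hD2 hD3 (by positivity) (norm_nonneg _)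
    rw [← pow_add, show 11 * n + 1 + (11 * n + 1) = 22 * n + 2 by ring, one_div_pow] at h
    exact h
  set P : ℝ := ‖((normT (aT n) (bT n) : ℚ) : ℂ)‖ with hP
  have hP0 : 0 ≤ P := norm_nonneg _
  have h22 : 22 * n = 2 * (11 * n) := by ring
  calc ‖gT n u‖
      = P * (‖uBlock n (15 * n + 2) (32 * n + 2) u‖ * ‖hBlock n (6 * n + 1) (11 * n + 1) u‖) /
          (‖hBlock n (13 * n + 1) (24 * n + 2) u‖ * ‖hBlock n (15 * n + 1) (26 * n + 2) u‖) := by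
        rw [gT_eq]
        simp only [norm_mul, norm_div, hP]
    _ ≤ P * (b ^ (17 * n) * b ^ (5 * n)) / (1 / 4 ^ (22 * n + 2)) :=
        div_le_div₀ (by positivity) (mul_le_mul_of_nonneg_left (mul_le_mul hU hH (norm_nonneg _) (by positivity)) hP0)
          (by positivity) hD
    _ = P * 4 ^ (22 * n + 2) * ((70 * n + 4) ^ (22 * n) * (1 + |u.im|) ^ (22 * n)) := by
        rw [div_div_eq_mul_div, div_one, ← pow_add, show 17 * n + 5 * n = 22 * n by ring, hb, mul_pow]
        ring
    _ ≤ P * 4 ^ (22 * n + 2) * ((70 * n + 4) ^ (22 * n) * (2 ^ (11 * n) * (1 + u.im ^ 2) ^ (11 * n))) := by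
        have h2 : (1 + |u.im|) ^ (22 * n) ≤ 2 ^ (11 * n) * (1 + u.im ^ 2) ^ (11 * n) := by
          rw [h22, pow_mul, ← mul_pow]
          exact pow_le_pow_left₀ (by positivity) (one_add_abs_sq_le_two_mul u.im) _
        exact mul_le_mul_of_nonneg_left (mul_le_mul_of_nonneg_left h2 (by positivity)) (by positivity)
    _ = (P * (70 * n + 4) ^ (22 * n) * 2 ^ (11 * n) * 4 ^ (22 * n + 2)) * (1 + u.im ^ 2) ^ (11 * n) := by ring

/-! ### The strip shift -/

/-- The line integral at the partner is `∫ sech1(y) g(x + iy) dy`. -/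
theorem lineT_T_eq (n : ℕ) (x : ℝ) :
    lineT (aT n) (bT n) x = ∫ y : ℝ, ((sech1 y : ℝ) : ℂ) * gT n ((x : ℂ) + (y : ℂ) * I) := by
  unfold lineT gT
  simp_rw [a0star_T_castC]

/-- **One step**: the line `k + 1 + ½` is minus the line `k + ½` (`k + 1 ≤ 11n`). -/
theorem lineT_succ {n k : ℕ} (hk : k + 1 ≤ 11 * n) :
    lineT (aT n) (bT n) (((k + 1 : ℕ) : ℝ) + 1 / 2) = -lineT (aT n) (bT n) ((k : ℝ) + 1 / 2) := by
  have h1 : 1 ≤ k + 1 := by omega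
  have eL : ((((k + 1 : ℕ) : ℤ) : ℝ) - 1 / 2 : ℝ) = (k : ℝ) + 1 / 2 := by push_cast; ring
  have eR : ((((k + 1 : ℕ) : ℤ) : ℝ) + 1 / 2 : ℝ) = ((k + 1 : ℕ) : ℝ) + 1 / 2 := by push_cast; ring
  have e0 : ((((k + 1 : ℕ) : ℤ)) : ℂ) = ((k + 1 : ℕ) : ℂ) := by norm_cast
  have h0 : gT n ((((k + 1 : ℕ) : ℤ)) : ℂ) = 0 := by rw [e0]; exact gT_natCast h1 hk
  have step := integral_sech1_step (differentiableOn_gT n h1) h0 (fun t ht => norm_gT_le h1 hk ht)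
  rw [eL, eR] at step
  rw [lineT_T_eq, lineT_T_eq, step, neg_neg]

/-- **The strip shift at the partner, PROVED**: `lineT(m + ½) = (−1)^m · lineT(½)` for `m ≤ 11n`. -/
theorem stripShiftT {n m : ℕ} (hm : m ≤ 11 * n) :
    lineT (aT n) (bT n) ((m : ℝ) + 1 / 2) = (-1) ^ m * lineT (aT n) (bT n) (1 / 2) := by
  induction m with
  | zero => simp
  | succ k ih => rw [lineT_succ (by omega), ih (by omega), pow_succ]; ring

/-- The shifted line integral has the same norm. -/
theorem norm_lineT_shift {n m : ℕ} (hm : m ≤ 11 * n) :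
    ‖lineT (aT n) (bT n) ((m : ℝ) + 1 / 2)‖ = ‖lineT (aT n) (bT n) (1 / 2)‖ := by
  rw [stripShiftT hm, norm_mul, norm_pow, norm_neg, norm_one, one_pow, one_mul]

/-! ### Corollary: the second-tale forms from ONE shifted line -/

/-- **`|q̂ₙ ζ(2) − p̂ₙ|` on any shifted line** (`n ≥ 1`, `m ≤ 11n`):
`|q̂ₙ ζ(2) − p̂ₙ| ≤ (4π)⁻¹ ∫ sech1(y) ‖g(m + ½ + iy)‖ dy`. -/
theorem abs_formT_le_of_line {n m : ℕ} (hn : 1 ≤ n) (hm : m ≤ 11 * n) :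
    |(formQT (aT n) (bT n) : ℝ) * zetaValue 2 - (formPT (aT n) (bT n) : ℝ)| ≤
      (1 / (4 * Real.pi)) * ∫ y : ℝ, sech1 y * ‖gT n ((((m : ℝ) + 1 / 2 : ℝ) : ℂ) + (y : ℂ) * I)‖ := by
  rw [abs_formT_eq (admissibleT hn), ← norm_lineT_shift hm, lineT_T_eq, div_eq_mul_one_div, mul_comm]
  refine mul_le_mul_of_nonneg_left ((norm_integral_le_integral_norm _).trans (le_of_eq ?_)) (by positivity)
  congr 1; funext y
  rw [norm_mul, Complex.norm_real, Real.norm_eq_abs, abs_of_nonneg (sech1_nonneg y)]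

end Summit.KontsevichZagierPeriods.Zeta5Search.TwoTaleSecondTaleStripShift

end
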